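import Mathlib
import HarnessLib
import Summits.PneNP.PneNP.Theorems.AeaCutRectanglesSparseCoreLemmaSix
import Summits.PneNP.PneNP.Theorems.AeaCutRectanglesSparseCores

/-!
# Crux `FoolingMeasure` (stmt-PneNP-19727): CORES BELOW AVERAGE DEGREE SIX CANNOT BE FOOLED

Lead prover pnp-aea-p1 g2 (2026-08-27), route `AeaCutRectangles`.  One more refuted weakening of X1
`Summit.PneNP.PneNP.Theses.AeaCutRectangles.FoolingMeasure`: feeding
`AeaCutRectanglesSparseCoreLemmaSix.halfSparse_of_core_lt_three` (HALF-SPARSE CORE for `|F| ≤ 3n - 11`) into the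
union bound `FoolingMeasure.Negative.total_le_of_halfSparseCore` of the conditional refutation (Bob-superset
rectangles of the pairs `(B, F[B])`, Stirling count against the threshold at `C = 4`):

* **`foolingMeasure_false_for_coresBelowSix`** — supports each containing a non-3-colourable subgraph `F` with a
  colour-critical edge and `|F| + 11 ≤ 3n` cannot fool.  So every X1 support graph and each of its 4-critical
  subgraphs has `≥ 3n - 10` edges — average degree `≥ 6 - O(1/n)` — above the degree of every regular 4-critical
  graph located by this seat (Gallai's 4-regular family, Jensen's 5-regular graph; the Dobrynin–Mel'nikov–Pyatkin
  even-regular graphs of degree 6 and 8, J. Graph Theory 46 (2004), are the standing test of the remaining dense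
  case, acquisition requests acq-13494 / acq-13495).  Supersedes the `(8n-20)/3` bound of
  `AeaCutRectanglesSparseCores.foolingMeasure_false_for_sparseCores`.

HONEST FRAMING: elementary counting; FRONTIER material for a rung of Fagin's complement ladder (NON-3-COL vs
ESO(∀∃∀)); restricted-model witness — nothing here bears on P vs NP.
-/

set_option linter.dupNamespace false
set_option autoImplicit false

namespace Summit.PneNP.PneNP.Theorems.AeaCutRectanglesSparseCoresSix

open Finset
open Summit.PneNP.PneNP.Theorems.AeaCutRectanglesDutyRectangles
open Summit.PneNP.PneNP.Theorems.AeaCutRectanglesSparseWitnesses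
open Summit.PneNP.PneNP.Theorems.AeaCutRectanglesNoSparseSupports
open Summit.PneNP.PneNP.Theorems.FoolingMeasure.Negative
open Summit.PneNP.PneNP.Theorems.AeaCutRectanglesSparseCoreLemmaSix

/-! ### X1 restricted to supports with a core of average degree below six is false -/

/-- **Cores below average degree six cannot be fooled.**  X1 restricted to measures each of whose support graphs
contains a non-3-colourable subgraph `F` with a colour-critical edge and `|F| + 11 ≤ 3n` is FALSE (same mechanism
as `AeaCutRectanglesSparseCores.foolingMeasure_false_for_sparseCores`, with `halfSparse_of_core_lt_three`).  Hence
every X1 support graph, and each of its 4-critical subgraphs, has at least `3n - 10` edges. -/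
theorem foolingMeasure_false_for_coresBelowSix :
    ¬ ∃ ε : ℝ, 0 < ε ∧ ε ≤ 1 / 4 ∧ ∀ C : ℕ, ∃ᶠ n in Filter.atTop, ∃ μ : Finset (Sym2 (Fin n)) → ℝ,
      (∀ S, 0 ≤ μ S) ∧ (∑ S, μ S = 1) ∧
      (∀ S, μ S ≠ 0 → (∀ e ∈ S, ¬ e.IsDiag) ∧
        ¬ (SimpleGraph.fromEdgeSet (S : Set (Sym2 (Fin n)))).Colorable 3) ∧
      (∀ S, μ S ≠ 0 → ∃ F, F ⊆ S ∧ ¬ (SimpleGraph.fromEdgeSet (F : Set (Sym2 (Fin n)))).Colorable 3 ∧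
        (∃ e ∈ F, (SimpleGraph.fromEdgeSet ((F.erase e : Finset (Sym2 (Fin n))) :
          Set (Sym2 (Fin n)))).Colorable 3) ∧ F.card + 11 ≤ 3 * n) ∧
      ∀ B : Finset (Fin n), (1 / 2 - ε) * (n : ℝ) ≤ B.card → (B.card : ℝ) ≤ (1 / 2 + ε) * n →
        ∀ 𝓐 𝓑 : Finset (Finset (Sym2 (Fin n))),
          (∀ α ∈ 𝓐, ∀ e ∈ α, ¬ e.IsDiag ∧ ∃ v ∈ e, v ∉ B) →
          (∀ β ∈ 𝓑, ∀ e ∈ β, ¬ e.IsDiag ∧ ∀ v ∈ e, v ∈ B) →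
          (∀ α ∈ 𝓐, ∀ β ∈ 𝓑,
            ¬ (SimpleGraph.fromEdgeSet ((α ∪ β : Finset (Sym2 (Fin n))) : Set (Sym2 (Fin n)))).Colorable 3) →
          ∑ q ∈ 𝓐 ×ˢ 𝓑, μ (q.1 ∪ q.2) ≤ (2 : ℝ) ^ (-((n : ℝ) / 2 * Real.logb 2 n) - (C : ℝ) * n) := by
  rintro ⟨ε, hε0, -, hC⟩
  obtain ⟨N₀, hN₀⟩ := exists_nat_gt (1 / ε)
  obtain ⟨n, hnN, μ, hμ, hsum, hs, hrestr, hX⟩ := Filter.frequently_atTop.1 (hC 4) (N₀ + 2)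
  have hn2 : 2 ≤ n := by omega
  have hnε : (1 : ℝ) ≤ ε * n := by
    have hNn : (N₀ : ℝ) ≤ n := by exact_mod_cast (show N₀ ≤ n by omega)
    have h := mul_le_mul_of_nonneg_left hNn hε0.le
    have h' : 1 < ε * N₀ := by
      rw [div_lt_iff₀ hε0] at hN₀
      linarith
    linarith
  set δ : ℝ := (2 : ℝ) ^ (-((n : ℝ) / 2 * Real.logb 2 n) - ((4 : ℕ) : ℝ) * n) with hδ
  have hδpos : 0 < δ := Real.rpow_pos_of_pos (by norm_num) _
  set m : ℕ := n / 2 with hm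
  have hrestr' : ∀ S, μ S ≠ 0 → ∃ B : Finset (Fin n),
      ((1 / 2 - ε) * (n : ℝ) ≤ B.card ∧ (B.card : ℝ) ≤ (1 / 2 + ε) * n) ∧ ∃ F, F ⊆ S ∧
        ¬ (SimpleGraph.fromEdgeSet (F : Set (Sym2 (Fin n)))).Colorable 3 ∧ (bobSide B F).card ≤ m := by
    intro S hS
    obtain ⟨hSl, -⟩ := hs S hS
    obtain ⟨F, hFS, hF, ⟨e, he, hFe⟩, hcard⟩ := hrestr S hS
    obtain ⟨T, hT, hTF⟩ := halfSparse_of_core_lt_three hn2 F (fun e' he' => hSl e' (hFS he')) he hFe hcard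
    obtain ⟨B, hBT, hBcard⟩ := exists_subset_card_eq (show (n + 1) / 2 ≤ T.card by omega)
    refine ⟨B, ⟨?_, ?_⟩, F, hFS, hF, ?_⟩
    · rw [hBcard]
      have : (n : ℝ) ≤ 2 * (((n + 1) / 2 : ℕ) : ℝ) := by
        exact_mod_cast (show n ≤ 2 * ((n + 1) / 2) by omega)
      nlinarith
    · rw [hBcard]
      have : 2 * (((n + 1) / 2 : ℕ) : ℝ) ≤ n + 1 := by
        exact_mod_cast (show 2 * ((n + 1) / 2) ≤ n + 1 by omega)
      nlinarith
    · have := card_le_card (bobSide_mono_left hBT F)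
      omega
  have htot := total_le_of_halfSparseCore μ hμ hs
    (fun B : Finset (Fin n) => (1 / 2 - ε) * (n : ℝ) ≤ B.card ∧ (B.card : ℝ) ≤ (1 / 2 + ε) * n)
    hδpos.le (fun B hB => hX B hB.1 hB.2) m hrestr'
  rw [hsum, Fintype.card_fin] at htot
  have hP : (((univ : Finset (Finset (Sym2 (Fin n)))).filter (fun H => H.card ≤ m)).card : ℝ) ≤
      (((n / 2 + 1) * (Fintype.card (Sym2 (Fin n))).choose (n / 2) : ℕ) : ℝ) := by
    have h := card_filter_card_le_choose (Sym2 (Fin n)) m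
      ((show 2 * m ≤ n by omega).trans (le_card_sym2_fin (by omega)))
    exact_mod_cast h
  have hlt := halfSparse_count_lt_one hn2
  rw [← hδ] at hlt
  have h2n : (0 : ℝ) ≤ ((2 ^ n : ℕ) : ℝ) := by positivity
  have := mul_le_mul_of_nonneg_left (mul_le_mul_of_nonneg_right hP hδpos.le) h2n
  linarith

end Summit.PneNP.PneNP.Theorems.AeaCutRectanglesSparseCoresSix
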